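import Literature.Analysis.FluidPDE.ParabolicMaximalFunctionLp
import HarnessLib

/-!
# The maximal function on parabolic cylinders is bounded on the Morrey spaces `ℳ₂^{p,q}`
(Lemarié-Rieusset 2016, Lemma 5.2, third item)

Analysis/FluidPDE proofs file in the decomposition of the named fact
`Literature.Analysis.FluidPDE.adams_parabolicRieszPotential` (Cor. 5.1, p. 112), over
`ParabolicMaximalFunctionLp.lean` (strong type `(p,p)` of the cylinder maximal function `𝓜`):
**Lemma 5.2, third item** — "for every `1 < p ≤ q < ∞` and for every `f ∈ Ṁ^{p,q}(X)`,
`‖𝓜_f‖_{Ṁ^{p,q}} ≤ C_{p,q} ‖f‖_{Ṁ^{p,q}}`" — in the cylinder form of `adams_parabolicRieszPotential`: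
if `∫∫_{Q_r(z)} Φ^p ≤ M r^{5(1-p/q)}` for all `z`, `r > 0`, then
`∫∫_{Q_R(z₀)} (𝓜Φ)^p ≤ C M R^{5(1-p/q)}` for all `z₀`, `R > 0`
(`parabolicMaximalFunction_morrey`). The printed proof is followed (p. 111): split
`Φ = Φ₁ + Φ₂`, `Φ₁ = Φ 1_{Q_{2R}(z₀)}`; `∫∫ (𝓜Φ₁)^p ≤ C_p ∫∫_{Q_{2R}(z₀)} Φ^p ≤ C_p M (2R)^{5(1-p/q)}` by the
strong type `(p,p)`; and for `y ∈ Q_R(z₀)` the cylinders `Q_ρ(y)`, `ρ ≤ R`, lie in `Q_{2R}(z₀)` where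
`Φ₂ = 0`, while for `ρ > R` Hölder and the Morrey bound give
`|Q_ρ|⁻¹ ∫∫_{Q_ρ(y)} Φ₂ ≤ M^{1/p} ρ^{(5-5p/q)/p} |Q_ρ|^{-1/p} = (2|B₁|)^{-1/p} M^{1/p} ρ^{-5/q} ≤ (2|B₁|)^{-1/p} M^{1/p} R^{-5/q}`,
so that `∫∫_{Q_R(z₀)} (𝓜Φ₂)^p ≤ |Q_R| (2|B₁|)⁻¹ M R^{-5p/q} = M R^{5(1-p/q)}`.

## References

* P. G. Lemarié-Rieusset, *The Navier–Stokes Problem in the 21st Century*, CRC Press (2016),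
  Lemma 5.2 and its proof (pp. 110–111). [LemarieRieusset2016]
* F. Chiarenza, M. Frasca, *Morrey spaces and Hardy–Littlewood maximal function*, Rend. Mat.
  Appl. 7 (1987), 273–279 (the Euclidean original).
-/

noncomputable section

open MeasureTheory Set Filter Topology Metric
open scoped NNReal ENNReal

namespace Literature.Analysis.FluidPDE

/-- Local notation for physical space `ℝ³ = EuclideanSpace ℝ (Fin 3)`. -/
local notation "ℝ³" => EuclideanSpace ℝ (Fin 3)

/-- Small cylinders centred in `Q_R(z₀)` stay in `Q_{2R}(z₀)`: `y ∈ Q_R(z₀)`, `0 < ρ ≤ R` imply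
`Q_ρ(y) ⊆ Q_{2R}(z₀)` (`ρ² + R² ≤ 2R² < (2R)²`, `ρ + R ≤ 2R`). [folklore] -/
theorem parabolicCylinderCentered_subset_of_mem {y z₀ : ℝ × ℝ³} {ρ R : ℝ}
    (hy : y ∈ FluidPDE.parabolicCylinderCentered R z₀) (hρR : ρ ≤ R) :
    FluidPDE.parabolicCylinderCentered ρ y ⊆ FluidPDE.parabolicCylinderCentered (2 * R) z₀ := by
  intro w hw
  rw [FluidPDE.mem_parabolicCylinderCentered] at hy hw ⊢
  obtain ⟨⟨a1, a2⟩, a3⟩ := hy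
  obtain ⟨⟨b1, b2⟩, b3⟩ := hw
  have hρ : 0 < ρ := lt_of_le_of_lt dist_nonneg b3
  have hR : 0 < R := lt_of_le_of_lt dist_nonneg a3
  have : ρ ^ 2 ≤ R ^ 2 := pow_le_pow_left₀ hρ.le hρR 2
  refine ⟨⟨by nlinarith, by nlinarith⟩, ?_⟩
  calc dist w.2 z₀.2 ≤ dist w.2 y.2 + dist y.2 z₀.2 := dist_triangle _ _ _
    _ < ρ + R := add_lt_add b3 a3
    _ ≤ 2 * R := by linarith

/-- The exponent bookkeeping of the far averages:
`ρ^{β/p} (2ρ⁵)^{-1/p} = 2^{-1/p} ρ^{-5/q}`, `β = 5(1-p/q)`. [folklore] -/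
theorem farAverage_rpow_identity {p q ρ : ℝ} (hp : 0 < p) (hq : 0 < q) (hρ : 0 < ρ) :
    ρ ^ (5 * (1 - p / q) / p) * (2 * ρ ^ 5) ^ (-(1 / p)) = (2 : ℝ) ^ (-(1 / p)) * ρ ^ (-(5 / q)) := by
  rw [Real.mul_rpow (by norm_num) (pow_nonneg hρ.le 5), ← Real.rpow_natCast ρ 5,
    ← Real.rpow_mul hρ.le]
  have hexp : ρ ^ (5 * (1 - p / q) / p) * ρ ^ ((5 : ℕ) * -(1 / p)) = ρ ^ (-(5 / q)) := by
    rw [← Real.rpow_add hρ]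
    congr 1
    push_cast
    field_simp
    ring
  calc ρ ^ (5 * (1 - p / q) / p) * ((2 : ℝ) ^ (-(1 / p)) * ρ ^ ((5 : ℕ) * -(1 / p)))
      = (2 : ℝ) ^ (-(1 / p)) * (ρ ^ (5 * (1 - p / q) / p) * ρ ^ ((5 : ℕ) * -(1 / p))) := by ring
    _ = _ := by rw [hexp]

/-- **The far part is uniformly small on `Q_R(z₀)`**: if `∫∫_{Q_r(z)} Φ^p ≤ M r^{5(1-p/q)}` for all
cylinders, then for `y ∈ Q_R(z₀)` the maximal function of `Φ₂ = Φ 1_{Q_{2R}(z₀)ᶜ}` satisfies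
`𝓜Φ₂(y) ≤ |B₁|^{-1/p} M^{1/p} 2^{-1/p} R^{-5/q}` (Lemarié-Rieusset 2016, p. 111:
"`1_{B(x,R)} 𝓜_{f₂} ≤ ‖f‖_{Ṁ^{p,q}} / (A R^{Q/q})`"). [cite: LemarieRieusset2016, proof of Lemma 5.2 p. 111] -/
theorem parabolicMaximalFunction_far_le {Φ : ℝ × ℝ³ → ℝ≥0∞} (hΦ : AEMeasurable Φ) {p q : ℝ}
    (hp : 1 < p) (hpq : p ≤ q) {M : ℝ≥0}
    (hM : ∀ (z : ℝ × ℝ³) (r : ℝ), 0 < r →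
      ∫⁻ w in FluidPDE.parabolicCylinderCentered r z, Φ w ^ p ≤
        M * ENNReal.ofReal (r ^ (5 * (1 - p / q))))
    {z₀ y : ℝ × ℝ³} {R : ℝ} (hR : 0 < R) (hy : y ∈ FluidPDE.parabolicCylinderCentered R z₀) :
    parabolicMaximalFunction ((FluidPDE.parabolicCylinderCentered (2 * R) z₀)ᶜ.indicator Φ) y ≤
      volume (ball (0 : ℝ³) 1) ^ (-(1 / p)) * (M : ℝ≥0∞) ^ (1 / p) *
        ENNReal.ofReal ((2 : ℝ) ^ (-(1 / p)) * R ^ (-(5 / q))) := by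
  have hp0 : 0 < p := by linarith
  have hq : 0 < q := by linarith
  set Q₂ := FluidPDE.parabolicCylinderCentered (2 * R) z₀ with hQ₂
  set V₁ : ℝ≥0∞ := volume (ball (0 : ℝ³) 1) with hV₁
  have hV₁t : V₁ ≠ ∞ := measure_ball_lt_top.ne
  refine iSup₂_le fun ρ hρ => ?_
  have hVρ0 := (volume_parabolicCylinderCentered_pos hρ y).ne'
  have hVρt := (volume_parabolicCylinderCentered_lt_top ρ y).ne
  rcases le_or_gt ρ R with hρR | hρR
  · -- small radii: `Φ₂ = 0` on `Q_ρ(y) ⊆ Q_{2R}(z₀)`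
    have hsub := parabolicCylinderCentered_subset_of_mem hy hρR
    have h0 : ∫⁻ w in FluidPDE.parabolicCylinderCentered ρ y, Q₂ᶜ.indicator Φ w = 0 := by
      refine le_antisymm ?_ (zero_le)
      calc ∫⁻ w in FluidPDE.parabolicCylinderCentered ρ y, Q₂ᶜ.indicator Φ w
          ≤ ∫⁻ _ in FluidPDE.parabolicCylinderCentered ρ y, (0 : ℝ≥0∞) :=
            setLIntegral_mono' (FluidPDE.isOpen_parabolicCylinderCentered _ _).measurableSet
              fun w hw => by
                rw [indicator_of_notMem (by simp only [mem_compl_iff, not_not]; exact hsub hw)]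
        _ = 0 := lintegral_zero
    rw [h0, mul_zero]
    exact zero_le
  · -- large radii: Hölder and the Morrey bound
    have hind_le : ∀ w, Q₂ᶜ.indicator Φ w ≤ Φ w := fun w => indicator_le_self _ _ w
    have hHolder : ∫⁻ w in FluidPDE.parabolicCylinderCentered ρ y, Φ w ≤
        (∫⁻ w in FluidPDE.parabolicCylinderCentered ρ y, Φ w ^ p) ^ (1 / p) *
          volume (FluidPDE.parabolicCylinderCentered ρ y) ^ (1 - 1 / p) := by
      have H := setLIntegral_rpow_le_rpow_mul_measure volume
        (FluidPDE.parabolicCylinderCentered ρ y) (F := Φ) hΦ.restrict one_pos hp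
      simpa only [ENNReal.rpow_one] using H
    have hV : (volume (FluidPDE.parabolicCylinderCentered ρ y))⁻¹ *
        volume (FluidPDE.parabolicCylinderCentered ρ y) ^ (1 - 1 / p) =
        V₁ ^ (-(1 / p)) * ENNReal.ofReal ((2 * ρ ^ 5) ^ (-(1 / p))) := by
      rw [← ENNReal.rpow_neg_one, ← ENNReal.rpow_add _ _ hVρ0 hVρt,
        show (-1 : ℝ) + (1 - 1 / p) = -(1 / p) by ring, volume_parabolicCylinderCentered hρ y,
        ENNReal.mul_rpow_of_ne_top ENNReal.ofReal_ne_top hV₁t,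
        ENNReal.ofReal_rpow_of_pos (by positivity : (0 : ℝ) < 2 * ρ ^ 5), mul_comm]
    calc (volume (FluidPDE.parabolicCylinderCentered ρ y))⁻¹ *
          ∫⁻ w in FluidPDE.parabolicCylinderCentered ρ y, Q₂ᶜ.indicator Φ w
        ≤ (volume (FluidPDE.parabolicCylinderCentered ρ y))⁻¹ *
            ((M * ENNReal.ofReal (ρ ^ (5 * (1 - p / q)))) ^ (1 / p) *
              volume (FluidPDE.parabolicCylinderCentered ρ y) ^ (1 - 1 / p)) := by
          refine mul_le_mul' le_rfl ((lintegral_mono fun w => hind_le w).trans (hHolder.trans ?_))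
          gcongr
          exact hM y ρ hρ
      _ = V₁ ^ (-(1 / p)) * (M : ℝ≥0∞) ^ (1 / p) *
            ENNReal.ofReal ((2 : ℝ) ^ (-(1 / p)) * ρ ^ (-(5 / q))) := by
          rw [ENNReal.mul_rpow_of_nonneg _ _ (by positivity : (0 : ℝ) ≤ 1 / p),
            ENNReal.ofReal_rpow_of_nonneg (by positivity) (by positivity : (0 : ℝ) ≤ 1 / p),
            ← Real.rpow_mul hρ.le, mul_one_div, ← farAverage_rpow_identity hp0 hq hρ,
            ENNReal.ofReal_mul (by positivity)]
          calc (volume (FluidPDE.parabolicCylinderCentered ρ y))⁻¹ *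
                ((M : ℝ≥0∞) ^ (1 / p) * ENNReal.ofReal (ρ ^ (5 * (1 - p / q) / p)) *
                  volume (FluidPDE.parabolicCylinderCentered ρ y) ^ (1 - 1 / p))
              = (M : ℝ≥0∞) ^ (1 / p) * ENNReal.ofReal (ρ ^ (5 * (1 - p / q) / p)) *
                  ((volume (FluidPDE.parabolicCylinderCentered ρ y))⁻¹ *
                    volume (FluidPDE.parabolicCylinderCentered ρ y) ^ (1 - 1 / p)) := by ring
            _ = _ := by rw [hV]; ring
      _ ≤ V₁ ^ (-(1 / p)) * (M : ℝ≥0∞) ^ (1 / p) *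
            ENNReal.ofReal ((2 : ℝ) ^ (-(1 / p)) * R ^ (-(5 / q))) := by
          have h5q : -(5 / q) ≤ 0 := by
            have : (0 : ℝ) < 5 / q := by positivity
            linarith
          exact mul_le_mul' le_rfl (ENNReal.ofReal_le_ofReal (mul_le_mul_of_nonneg_left
            (Real.rpow_le_rpow_of_nonpos hR hρR.le h5q) (Real.rpow_nonneg (by norm_num) _)))

/-- The constant bound of the far part integrates to `M R^{5(1-p/q)}` over `Q_R(z₀)`:
`(|B₁|^{-1/p} M^{1/p} 2^{-1/p} R^{-5/q})^p |Q_R| = M R^{5(1-p/q)}` (`|Q_R| = 2R⁵|B₁|`). [folklore] -/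
theorem farBound_rpow_mul_volume {p q R : ℝ} (hp : 0 < p) (hq : 0 < q) (hR : 0 < R) (M : ℝ≥0)
    (z₀ : ℝ × ℝ³) :
    (volume (ball (0 : ℝ³) 1) ^ (-(1 / p)) * (M : ℝ≥0∞) ^ (1 / p) *
        ENNReal.ofReal ((2 : ℝ) ^ (-(1 / p)) * R ^ (-(5 / q)))) ^ p *
      volume (FluidPDE.parabolicCylinderCentered R z₀) =
      M * ENNReal.ofReal (R ^ (5 * (1 - p / q))) := by
  set V₁ : ℝ≥0∞ := volume (ball (0 : ℝ³) 1) with hV₁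
  have hV₁0 : V₁ ≠ 0 := (measure_ball_pos _ _ one_pos).ne'
  have hV₁t : V₁ ≠ ∞ := measure_ball_lt_top.ne
  have hpne : p ≠ 0 := hp.ne'
  have hreal : ((2 : ℝ) ^ (-(1 / p)) * R ^ (-(5 / q))) ^ p * (2 * R ^ 5) =
      R ^ (5 * (1 - p / q)) := by
    rw [Real.mul_rpow (Real.rpow_nonneg (by norm_num) _) (Real.rpow_nonneg hR.le _),
      ← Real.rpow_mul (by norm_num), ← Real.rpow_mul hR.le,
      show -(1 / p) * p = -1 by field_simp, Real.rpow_neg_one]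
    have h5 : R ^ (-(5 / q) * p) * R ^ (5 : ℕ) = R ^ (5 * (1 - p / q)) := by
      rw [← Real.rpow_natCast R 5, ← Real.rpow_add hR]
      congr 1
      push_cast
      field_simp
      ring
    calc (2 : ℝ)⁻¹ * R ^ (-(5 / q) * p) * (2 * R ^ 5) = R ^ (-(5 / q) * p) * R ^ (5 : ℕ) := by ring
      _ = _ := h5
  rw [ENNReal.mul_rpow_of_nonneg _ _ hp.le, ENNReal.mul_rpow_of_nonneg _ _ hp.le,
    ← ENNReal.rpow_mul, ← ENNReal.rpow_mul, show -(1 / p) * p = -1 by field_simp,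
    show 1 / p * p = 1 by field_simp, ENNReal.rpow_neg_one, ENNReal.rpow_one,
    ENNReal.ofReal_rpow_of_nonneg (by positivity) hp.le, volume_parabolicCylinderCentered hR z₀]
  calc V₁⁻¹ * (M : ℝ≥0∞) * ENNReal.ofReal (((2 : ℝ) ^ (-(1 / p)) * R ^ (-(5 / q))) ^ p) *
        (ENNReal.ofReal (2 * R ^ 5) * V₁)
      = (M : ℝ≥0∞) * (ENNReal.ofReal (((2 : ℝ) ^ (-(1 / p)) * R ^ (-(5 / q))) ^ p) *
          ENNReal.ofReal (2 * R ^ 5)) * (V₁⁻¹ * V₁) := by ring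
    _ = M * ENNReal.ofReal (R ^ (5 * (1 - p / q))) := by
        rw [ENNReal.inv_mul_cancel hV₁0 hV₁t, mul_one, ← ENNReal.ofReal_mul (by positivity),
          hreal]

/-- **Lemma 5.2, third item, on parabolic cylinders**: the maximal function is bounded on the
Morrey spaces, in the form: there is `C = C(p,q) < ∞` (`1 < p ≤ q`) such that for every
a.e.-measurable `Φ ≥ 0` with `∫∫_{Q_r(z)} Φ^p ≤ M r^{5(1-p/q)}` for all `z`, `r > 0`,
`∫∫_{Q_R(z₀)} (𝓜Φ)^p ≤ C M R^{5(1-p/q)}` for all `z₀`, `R > 0` (Lemarié-Rieusset 2016, Lemma 5.2: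
"`‖𝓜_f‖_{Ṁ^{p,q}} ≤ C_{p,q} ‖f‖_{Ṁ^{p,q}}`", with the cylinders `Q_r(t,x)` of p. 462 in place of
the `δ₂`-balls). Split `Φ = Φ 1_{Q_{2R}(z₀)} + Φ 1_{Q_{2R}(z₀)ᶜ}`; the first part by the strong type
`(p,p)`, the second by `parabolicMaximalFunction_far_le`. [cite: LemarieRieusset2016, Lemma 5.2 p. 111] -/
theorem parabolicMaximalFunction_morrey {p q : ℝ} (hp : 1 < p) (hpq : p ≤ q) :
    ∃ C : ℝ≥0∞, C < ∞ ∧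
      ∀ (Φ : ℝ × ℝ³ → ℝ≥0∞) (M : ℝ≥0), AEMeasurable Φ →
        (∀ (z : ℝ × ℝ³) (r : ℝ), 0 < r →
          ∫⁻ w in FluidPDE.parabolicCylinderCentered r z, Φ w ^ p ≤
            M * ENNReal.ofReal (r ^ (5 * (1 - p / q)))) →
        ∀ (z₀ : ℝ × ℝ³) (R : ℝ), 0 < R →
          ∫⁻ y in FluidPDE.parabolicCylinderCentered R z₀, parabolicMaximalFunction Φ y ^ p ≤
            C * M * ENNReal.ofReal (R ^ (5 * (1 - p / q))) := by
  have hp0 : 0 < p := by linarith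
  have hq : 0 < q := by linarith
  set Cp : ℝ≥0∞ := ENNReal.ofReal p * (2 * 5 ^ 5) * ((2 : ℝ≥0∞) ^ (p - 1) / ENNReal.ofReal (p - 1))
    with hCp
  have hCpt : Cp < ∞ := parabolicMaximalLpConst_lt_top hp
  set C : ℝ≥0∞ := (2 : ℝ≥0∞) ^ (p - 1) * (Cp * ENNReal.ofReal ((2 : ℝ) ^ (5 * (1 - p / q))) + 1)
    with hC
  refine ⟨C, ?_, fun Φ M hΦ hM z₀ R hR => ?_⟩
  · exact ENNReal.mul_lt_top (ENNReal.rpow_lt_top_of_nonneg (by linarith) ENNReal.ofNat_ne_top)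
      (ENNReal.add_lt_top.2 ⟨ENNReal.mul_lt_top hCpt ENNReal.ofReal_lt_top, ENNReal.one_lt_top⟩)
  set Q := FluidPDE.parabolicCylinderCentered R z₀ with hQ
  set Q₂ := FluidPDE.parabolicCylinderCentered (2 * R) z₀ with hQ₂
  have hQm : MeasurableSet Q := (FluidPDE.isOpen_parabolicCylinderCentered _ _).measurableSet
  have hQ₂m : MeasurableSet Q₂ := (FluidPDE.isOpen_parabolicCylinderCentered _ _).measurableSet
  set Φ₁ : ℝ × ℝ³ → ℝ≥0∞ := Q₂.indicator Φ with hΦ₁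
  set Φ₂ : ℝ × ℝ³ → ℝ≥0∞ := Q₂ᶜ.indicator Φ with hΦ₂
  have hΦ₁m : AEMeasurable Φ₁ := hΦ.indicator hQ₂m
  -- `𝓜Φ ≤ 𝓜Φ₁ + 𝓜Φ₂` and the convexity bound
  have hsplit : Φ = fun w => Φ₁ w + Φ₂ w := by
    funext w
    by_cases hw : w ∈ Q₂
    · rw [hΦ₁, hΦ₂, indicator_of_mem hw,
        indicator_of_notMem (by simp only [mem_compl_iff, not_not]; exact hw), add_zero]
    · rw [hΦ₁, hΦ₂, indicator_of_notMem hw, indicator_of_mem (mem_compl hw), zero_add]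
  have hpt : ∀ y, parabolicMaximalFunction Φ y ^ p ≤ (2 : ℝ≥0∞) ^ (p - 1) *
      (parabolicMaximalFunction Φ₁ y ^ p + parabolicMaximalFunction Φ₂ y ^ p) := by
    intro y
    have h1 : parabolicMaximalFunction Φ y ≤
        parabolicMaximalFunction Φ₁ y + parabolicMaximalFunction Φ₂ y := by
      have h := parabolicMaximalFunction_add_le (G := Φ₂) hΦ₁m y
      rwa [← hsplit] at h
    exact (ENNReal.rpow_le_rpow h1 hp0.le).trans (ENNReal.rpow_add_le_mul_rpow_add_rpow _ _ hp.le)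
  -- Term 1: the strong type `(p,p)` on `Φ₁`
  have hT1 : ∫⁻ y in Q, parabolicMaximalFunction Φ₁ y ^ p ≤
      Cp * ENNReal.ofReal ((2 : ℝ) ^ (5 * (1 - p / q))) * M *
        ENNReal.ofReal (R ^ (5 * (1 - p / q))) := by
    have hind : ∫⁻ w, Φ₁ w ^ p = ∫⁻ w in Q₂, Φ w ^ p := by
      have : (fun w => Φ₁ w ^ p) = Q₂.indicator fun w => Φ w ^ p := by
        funext w
        by_cases hw : w ∈ Q₂
        · rw [hΦ₁, indicator_of_mem hw, indicator_of_mem hw]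
        · rw [hΦ₁, indicator_of_notMem hw, indicator_of_notMem hw, ENNReal.zero_rpow_of_pos hp0]
      rw [this, lintegral_indicator hQ₂m]
    calc ∫⁻ y in Q, parabolicMaximalFunction Φ₁ y ^ p
        ≤ ∫⁻ y, parabolicMaximalFunction Φ₁ y ^ p := setLIntegral_le_lintegral _ _
      _ ≤ Cp * ∫⁻ w, Φ₁ w ^ p := lintegral_parabolicMaximalFunction_rpow_le hΦ₁m hp
      _ ≤ Cp * (M * ENNReal.ofReal ((2 * R) ^ (5 * (1 - p / q)))) := by
          rw [hind]
          exact mul_le_mul' le_rfl (hM z₀ (2 * R) (by linarith))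
      _ = Cp * ENNReal.ofReal ((2 : ℝ) ^ (5 * (1 - p / q))) * M *
            ENNReal.ofReal (R ^ (5 * (1 - p / q))) := by
          rw [Real.mul_rpow (by norm_num) hR.le, ENNReal.ofReal_mul (by positivity)]
          ring
  -- Term 2: the far part is bounded on `Q`
  have hT2 : ∫⁻ y in Q, parabolicMaximalFunction Φ₂ y ^ p ≤
      M * ENNReal.ofReal (R ^ (5 * (1 - p / q))) := by
    set Λ : ℝ≥0∞ := volume (ball (0 : ℝ³) 1) ^ (-(1 / p)) * (M : ℝ≥0∞) ^ (1 / p) *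
      ENNReal.ofReal ((2 : ℝ) ^ (-(1 / p)) * R ^ (-(5 / q))) with hΛ
    calc ∫⁻ y in Q, parabolicMaximalFunction Φ₂ y ^ p ≤ ∫⁻ _ in Q, Λ ^ p :=
          setLIntegral_mono' hQm fun y hy =>
            ENNReal.rpow_le_rpow (parabolicMaximalFunction_far_le hΦ hp hpq hM hR hy) hp0.le
      _ = Λ ^ p * volume Q := setLIntegral_const _ _
      _ = M * ENNReal.ofReal (R ^ (5 * (1 - p / q))) := farBound_rpow_mul_volume hp0 hq hR M z₀
  -- assembly
  have h2t : (2 : ℝ≥0∞) ^ (p - 1) ≠ ∞ :=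
    ENNReal.rpow_ne_top_of_nonneg (by linarith) ENNReal.ofNat_ne_top
  have hM₁m : Measurable fun y => parabolicMaximalFunction Φ₁ y ^ p :=
    (measurable_parabolicMaximalFunction Φ₁).pow_const p
  calc ∫⁻ y in Q, parabolicMaximalFunction Φ y ^ p
      ≤ ∫⁻ y in Q, (2 : ℝ≥0∞) ^ (p - 1) *
          (parabolicMaximalFunction Φ₁ y ^ p + parabolicMaximalFunction Φ₂ y ^ p) :=
        lintegral_mono fun y => hpt y
    _ = (2 : ℝ≥0∞) ^ (p - 1) * ((∫⁻ y in Q, parabolicMaximalFunction Φ₁ y ^ p) +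
          ∫⁻ y in Q, parabolicMaximalFunction Φ₂ y ^ p) := by
        rw [lintegral_const_mul' _ _ h2t, lintegral_add_left hM₁m]
    _ ≤ (2 : ℝ≥0∞) ^ (p - 1) * (Cp * ENNReal.ofReal ((2 : ℝ) ^ (5 * (1 - p / q))) * M *
          ENNReal.ofReal (R ^ (5 * (1 - p / q))) + M * ENNReal.ofReal (R ^ (5 * (1 - p / q)))) :=
        mul_le_mul' le_rfl (add_le_add hT1 hT2)
    _ = C * M * ENNReal.ofReal (R ^ (5 * (1 - p / q))) := by rw [hC]; ring

end Literature.Analysis.FluidPDE
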